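import Mathlib
import Literature.Analysis.FluidPDE.VectorCalculus
import Literature.Analysis.FluidPDE.DivFreeVectorPotential
import Literature.Analysis.FluidPDE.LoadedSphereDynamics
import Literature.Geometry.DiscreteGeometry.LayerShells
import Summits.NavierStokesRegularity.NavierStokesRegularity.Theorems.ThreadingFluxErtelTowerLinearFlowDichotomy
import Summits.NavierStokesRegularity.NavierStokesRegularity.Theorems.ThreadingFluxErtelTowerAffineFlowFrame
import HarnessLib

/-!
# Crux `PoloidalLiouville` (stmt-NavierStokesRegularity-1222, W1), crux idea «radial-jerk-tower» (ns-idea-15 g7):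
# INVISCID AFFINE-FLOW RIGIDITY, III — THE AFFINE DICHOTOMY for divergence-free drifts

Support file (`--supports stmt-NavierStokesRegularity-1222`, helper).  Experiment cell `ns-wall-extremal`, width hand
ns-wall-eng-5 g8, item (ε) E4c.  0 kit.

The 1-jet of a smooth divergence-free drift at ANY point `x₀` is the affine field `u = v + A(x − x₀)` with `tr A = 0`.  Files
`…AffineFlowRigidity` (E4) and `…AffineFlowFrame` (E4b) reduced the inviscid shadow about `x₀` to the affine discriminant
`p(z) = ⟪z, (v + Mz) × (A†(v + Mz) + M(v + Az))⟫` and computed it in an eigenframe of `M = A + A†`.  Here the classification: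

* `adjoint_of_eq_smul_add_cross`, `affDisc_of_isotropic` — for an isotropic gradient `A = λ·id + [ω]×` the discriminant collapses to
  `p(z) = −⟪z, v × (ω × v)⟫`; `affDisc_isotropic_ne_zero`: it is non-zero at `z = v × (ω × v)` as soon as `ω × v ≠ 0`;
* `affDisc_twoRate_cases` — two equal rates `e₀ = e₁ ≠ e₂` (trace-free): either `p ≢ 0`, or the spin is along the axis `u₂` AND `v`
  is along `u₂` (then `A` commutes with `z ↦ u₂ × z` and `u₂ × v = 0`); the sub-cases use the E4b values of `p` at `R⁻¹(0,0,1)`,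
  `R⁻¹(1,0,0)`, `R⁻¹(0,1,0)` and `R⁻¹(ν₁,−ν₀,1)` (the last one needs `tr A = 0`: for rates `(2,2,1)·n` the in-plane class is degenerate);
* ★ `affDisc_ne_zero_or_aligned` — for EVERY trace-free `A` and every `v`: either `p(z₀) ≠ 0` for some `z₀`, or there is `w ≠ 0` with
  `A ∘ [w]× = [w]× ∘ A` and `w × v = 0`;
* ★★★ `inviscidAffineFlow_dichotomy` — **THE INVISCID LINEARISED WALL ABOUT AN ARBITRARY POINT, DECIDED AT FIRST ORDER**: for a
  divergence-free affine drift `u = v + A(x − x₀)` (`tr A = 0`), a NON-ZERO smooth field frozen into `u` and tangent to the spheres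
  about `x₀` exists on some open space-time set IFF the 1-jet is AXISYMMETRIC ABOUT AN AXIS THROUGH `x₀`: `A` commutes with a rotation
  generator `z ↦ w × z` (`w ≠ 0`) AND the centre value `v = u(x₀)` lies on that axis (`w × v = 0`).  Witness: `w × (x − x₀)` (E4);
  obstruction: `inviscidKinematicRigidity` BY NAME through the affine discriminant.

HONEST FRAME: statements about the INVISCID AFFINE shadow (prescribed affine drift); helper/information-grade; W1 movement 0;
`PoloidalLiouville` (1222) / (27585) OPEN; NS regularity NOT proved.
-/

-- the summit and its single problem share the name (D-0017 nested layout)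
set_option linter.dupNamespace false

noncomputable section

namespace Summit.NavierStokesRegularity.NavierStokesRegularity.Theorems.PoloidalLiouville.ErtelTower

open Set Function
open scoped Topology RealInnerProductSpace InnerProductSpace
open Literature.Analysis.FluidPDE
open Literature.Geometry.DiscreteGeometry (inner_fin3)
open Summit.NavierStokesRegularity.NavierStokesRegularity.Theorems.PoloidalLiouville.HorizonTower (E3 cross_fin3)
open Summit.NavierStokesRegularity.NavierStokesRegularity.Theorems.PoloidalLiouville.HorizonTower.Zonal
  (inner_cross_self_left inner_cross_self_right)
open Summit.NavierStokesRegularity.NavierStokesRegularity.Theorems.PoloidalLiouville.CentreJet.TriaxialFrame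
  (exists_orthonormalBasis_eq)

/-! ### The isotropic gradient `A = λ·id + [ω]×` -/

section Isotropic

variable {A : E3 →L[ℝ] E3} {lam : ℝ} {ω : E3}

/-- The adjoint of `λ·id + [ω]×` is `λ·id − [ω]×`. -/
theorem adjoint_of_eq_smul_add_cross (hA : ∀ z : E3, A z = lam • z + cross ω z) (z : E3) :
    (ContinuousLinearMap.adjoint A) z = lam • z - cross ω z := by
  apply ext_inner_right ℝ
  intro y
  rw [ContinuousLinearMap.adjoint_inner_left, hA y, inner_add_right, real_inner_smul_right, inner_sub_left,
    real_inner_smul_left, inner_cross_right_eq_neg_inner_cross_left]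
  ring

/-- **The affine discriminant of an isotropic gradient** `A = λ·id + [ω]×` collapses to `p(z) = −⟪z, v × (ω × v)⟫`. -/
theorem affDisc_of_isotropic (hA : ∀ z : E3, A z = lam • z + cross ω z) (v z : E3) :
    ⟪z, cross (v + (A + ContinuousLinearMap.adjoint A) z)
      ((ContinuousLinearMap.adjoint A) (v + (A + ContinuousLinearMap.adjoint A) z)
        + (A + ContinuousLinearMap.adjoint A) (v + A z))⟫ = -⟪z, cross v (cross ω v)⟫ := by
  have hM : ∀ y : E3, (A + ContinuousLinearMap.adjoint A) y = (2 * lam) • y := fun y => by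
    rw [add_apply, hA, adjoint_of_eq_smul_add_cross hA]
    module
  rw [hM, hM, adjoint_of_eq_smul_add_cross hA, hA z]
  have h1 : cross v v = 0 := KinematicShadow.PointSource.cross_self v
  have h2 : ⟪z, cross v z⟫ = 0 := by rw [real_inner_comm]; exact inner_cross_self_right v z
  have h3 : ∀ y : E3, ⟪z, cross z y⟫ = 0 := fun y => by rw [real_inner_comm]; exact inner_cross_self_left z y
  simp only [smul_add, map_add, map_smul, map_sub, ← crossCLM_apply, add_apply, smul_apply, inner_add_right,
    inner_smul_right, inner_sub_right]
  simp only [crossCLM_apply, h1, h2, h3, inner_zero_right, mul_zero, add_zero, zero_add, zero_sub]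
  ring

/-- ★ For an isotropic gradient with `ω × v ≠ 0` the affine discriminant is non-zero at `z = v × (ω × v)`. -/
theorem affDisc_isotropic_ne_zero (hA : ∀ z : E3, A z = lam • z + cross ω z) {v : E3} (hv : cross ω v ≠ 0) :
    ∃ z₀ : E3, ⟪z₀, cross (v + (A + ContinuousLinearMap.adjoint A) z₀)
      ((ContinuousLinearMap.adjoint A) (v + (A + ContinuousLinearMap.adjoint A) z₀)
        + (A + ContinuousLinearMap.adjoint A) (v + A z₀))⟫ ≠ 0 := by
  refine ⟨cross v (cross ω v), ?_⟩
  rw [affDisc_of_isotropic hA, real_inner_self_eq_norm_sq, neg_ne_zero]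
  have hne : cross v (cross ω v) ≠ 0 := by
    intro h0
    -- `⟪ω, v × (ω × v)⟫ = ‖ω × v‖²`
    have h : ⟪ω, cross v (cross ω v)⟫ = ‖cross ω v‖ ^ 2 := by
      rw [inner_cross_cyclic ω v (cross ω v), inner_cross_cyclic v (cross ω v) ω, real_inner_self_eq_norm_sq]
    rw [h0, inner_zero_right] at h
    exact hv (norm_eq_zero.mp (by nlinarith [norm_nonneg (cross ω v)]))
  exact pow_ne_zero 2 (norm_ne_zero_iff.mpr hne)

end Isotropic

/-! ### Two equal rates (trace-free): the sub-cases -/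

section TwoRate

variable {A : E3 →L[ℝ] E3} {v : E3} {u : Fin 3 → E3} {e : Fin 3 → ℝ}

/-- **Two equal rates, trace-free.**  If `M = A + A†` has an orthonormal eigenframe with `e₀ = e₁ ≠ e₂` and `Σ eᵢ = 0`, then either the
affine discriminant of `v + A z` is non-zero somewhere, or the spin AND the centre value are along the axis `u₂`:
`A` commutes with `z ↦ u₂ × z` and `u₂ × v = 0`. -/
theorem affDisc_twoRate_cases (hu : Orthonormal ℝ u) (h01 : e 0 = e 1) (h12 : e 1 ≠ e 2) (hsum : e 0 + e 1 + e 2 = 0)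
    (hM : ∀ i, (A + ContinuousLinearMap.adjoint A) (u i) = e i • u i) :
    (∃ z₀ : E3, ⟪z₀, cross (v + (A + ContinuousLinearMap.adjoint A) z₀)
      ((ContinuousLinearMap.adjoint A) (v + (A + ContinuousLinearMap.adjoint A) z₀)
        + (A + ContinuousLinearMap.adjoint A) (v + A z₀))⟫ ≠ 0) ∨
    (∃ w : E3, w ≠ 0 ∧ (∀ z : E3, A (cross w z) = cross w (A z)) ∧ cross w v = 0) := by
  obtain ⟨ob, hob⟩ := exists_orthonormalBasis_eq hu
  obtain ⟨ε, hε1, hε⟩ := exists_sign_cross_map ob.repr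
  have hε0 : ε ≠ 0 := by rcases hε1 with h | h <;> simp [h]
  have h12' : e 1 - e 2 ≠ 0 := sub_ne_zero.mpr h12
  -- tilted spin: already the LINEAR discriminant is non-zero somewhere
  by_cases htilt : ⟪u 0, A (u 2)⟫ ≠ 0 ∨ ⟪u 1, A (u 2)⟫ ≠ 0
  · left
    obtain ⟨d, hd⟩ := linDisc_exists_ne_zero_of_twoRate A u e hu h01 h12 hM htilt
    set M : E3 →L[ℝ] E3 := A + ContinuousLinearMap.adjoint A with hMdef
    set Q : E3 →L[ℝ] E3 := (ContinuousLinearMap.adjoint A).comp M + M.comp A with hQ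
    have hQapply : ∀ z, Q z = (ContinuousLinearMap.adjoint A) (M z) + M (A z) := fun z => rfl
    have hexp : ∀ z : E3, (ContinuousLinearMap.adjoint A) (v + M z) + M (v + A z)
        = ((ContinuousLinearMap.adjoint A) v + M v) + Q z := fun z => by
      rw [hQapply, map_add, map_add]; abel
    have hd' : ⟪d, cross (M d) (Q d)⟫ ≠ 0 := by rw [hQapply]; exact hd
    obtain ⟨z₀, hz₀⟩ := (dense_affDisc_ne_zero v ((ContinuousLinearMap.adjoint A) v + M v) M Q hd').nonempty
    exact ⟨z₀, by rw [hexp]; exact hz₀⟩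
  push Not at htilt
  obtain ⟨w02, w12⟩ := htilt
  have hcomm : ∀ z : E3, A (cross (u 2) z) = cross (u 2) (A z) := commute_cross_of_twoRate_aligned hu h01 hM w02 w12
  by_cases hplane : ⟪u 0, v⟫ = 0 ∧ ⟪u 1, v⟫ = 0
  · -- the centre value is along the axis
    right
    refine ⟨u 2, hu.ne_zero 2, hcomm, ?_⟩
    have hv : v = ⟪u 2, v⟫ • u 2 := by
      have h := frame_expand hob v
      rw [hplane.1, hplane.2, zero_smul, zero_smul, zero_add, zero_add] at h
      exact h
    rw [hv, ← crossCLM_apply, map_smul, crossCLM_apply, KinematicShadow.PointSource.cross_self, smul_zero]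
  · left
    have hνsq : ⟪u 0, v⟫ ^ 2 + ⟪u 1, v⟫ ^ 2 ≠ 0 := by
      intro h0
      have h0' : ⟪u 0, v⟫ = 0 := by nlinarith [sq_nonneg ⟪u 0, v⟫, sq_nonneg ⟪u 1, v⟫]
      have h1' : ⟪u 1, v⟫ = 0 := by nlinarith [sq_nonneg ⟪u 0, v⟫, sq_nonneg ⟪u 1, v⟫]
      exact hplane ⟨h0', h1'⟩
    by_cases hspin : ⟪u 0, A (u 1)⟫ ≠ 0
    · -- spin about the axis: the value at `R⁻¹(0,0,1)` is `ε w₀₁ (ν₀² + ν₁²)`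
      refine ⟨ob.repr.symm (WithLp.toLp 2 ![0, 0, 1]), ?_⟩
      rw [affDisc_at_axis hu hob hM hε1 hε, w02, w12, h01]
      have : ε * (⟪u 0, A (u 1)⟫ * (⟪u 0, v⟫ ^ 2 + ⟪u 1, v⟫ ^ 2) + 3 / 2 * (e 1 - e 1) * ⟪u 0, v⟫ * ⟪u 1, v⟫
          + ⟪u 2, v⟫ * (0 * ⟪u 1, v⟫ - 0 * ⟪u 0, v⟫) + (e 1 - e 2) * 0 * ⟪u 0, v⟫ - (e 1 - e 2) * 0 * ⟪u 1, v⟫)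
          = ε * ⟪u 0, A (u 1)⟫ * (⟪u 0, v⟫ ^ 2 + ⟪u 1, v⟫ ^ 2) := by ring
      rw [this]
      exact mul_ne_zero (mul_ne_zero hε0 hspin) hνsq
    · push Not at hspin
      by_cases hν2 : ⟪u 2, v⟫ ≠ 0
      · -- pure strain, centre value off the symmetry plane: test points `R⁻¹(1,0,0)`, `R⁻¹(0,1,0)`
        by_cases hν1 : ⟪u 1, v⟫ ≠ 0
        · refine ⟨ob.repr.symm (WithLp.toLp 2 ![1, 0, 0]), ?_⟩
          rw [affDisc_at_e0 hu hob hM hε1 hε, w02, w12, hspin]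
          have : ε * (⟪u 1, v⟫ * (3 / 2 * e 2 * ⟪u 2, v⟫ + 0 * ⟪u 0, v⟫ + 0 * ⟪u 1, v⟫ + (e 0 - e 2) * 0)
              - ⟪u 2, v⟫ * (3 / 2 * e 1 * ⟪u 1, v⟫ + 0 * ⟪u 0, v⟫ - 0 * ⟪u 2, v⟫ + (e 0 - e 1) * 0))
              = ε * (3 / 2) * (⟪u 1, v⟫ * ⟪u 2, v⟫) * -(e 1 - e 2) := by ring
          rw [this]
          exact mul_ne_zero (mul_ne_zero (mul_ne_zero hε0 (by norm_num)) (mul_ne_zero hν1 hν2)) (neg_ne_zero.mpr h12')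
        · push Not at hν1
          have hν0 : ⟪u 0, v⟫ ≠ 0 := fun h => hplane ⟨h, hν1⟩
          refine ⟨ob.repr.symm (WithLp.toLp 2 ![0, 1, 0]), ?_⟩
          rw [affDisc_at_e1 hu hob hM hε1 hε, w02, w12, hspin, hν1]
          have : ε * (⟪u 2, v⟫ * (3 / 2 * e 0 * ⟪u 0, v⟫ - 0 * 0 - 0 * ⟪u 2, v⟫ + (e 0 - e 1) * 0)
              - ⟪u 0, v⟫ * (3 / 2 * e 2 * ⟪u 2, v⟫ + 0 * ⟪u 0, v⟫ + 0 * 0 + (e 1 - e 2) * 0))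
              = ε * (3 / 2) * (⟪u 0, v⟫ * ⟪u 2, v⟫) * (e 0 - e 2) := by ring
          rw [this, h01]
          exact mul_ne_zero (mul_ne_zero (mul_ne_zero hε0 (by norm_num)) (mul_ne_zero hν0 hν2)) h12'
      · -- pure strain, centre value IN the symmetry plane: the «swirl» point; needs `tr A = 0` (`e₂ = −2e₀`)
        push Not at hν2
        refine ⟨ob.repr.symm (WithLp.toLp 2 ![⟪u 1, v⟫, -⟪u 0, v⟫, 1]), ?_⟩
        rw [affDisc_at_swirl hu hob hM hε1 hε h01 hspin w02 w12 hν2]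
        have he2 : e 2 = -2 * e 0 := by linarith
        have he0 : e 0 ≠ 0 := by
          intro h0
          apply h12
          rw [← h01, he2, h0]; ring
        rw [he2]
        have : ε * (1 / 2 * (2 * (-2 * e 0) - e 0) * (-2 * e 0 - e 0) * (⟪u 0, v⟫ ^ 2 + ⟪u 1, v⟫ ^ 2))
            = ε * (15 / 2) * e 0 ^ 2 * (⟪u 0, v⟫ ^ 2 + ⟪u 1, v⟫ ^ 2) := by ring
        rw [this]
        exact mul_ne_zero (mul_ne_zero (mul_ne_zero hε0 (by norm_num)) (pow_ne_zero 2 he0)) hνsq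

end TwoRate

/-! ### The classification and the affine dichotomy -/

section Dichotomy

/-- Three pairwise distinct values on `Fin 3` form an injective family. -/
theorem injective_of_pairwise_ne {e : Fin 3 → ℝ} (h01 : e 0 ≠ e 1) (h12 : e 1 ≠ e 2) (h02 : e 0 ≠ e 2) :
    Function.Injective e := by
  intro i j hij
  fin_cases i <;> fin_cases j <;> simp_all

/-- The adjoint has the same trace (orthonormal-basis expansion). -/
theorem trace_adjoint (A : E3 →L[ℝ] E3) :
    LinearMap.trace ℝ E3 ((ContinuousLinearMap.adjoint A : E3 →L[ℝ] E3) : E3 →ₗ[ℝ] E3)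
      = LinearMap.trace ℝ E3 (A : E3 →ₗ[ℝ] E3) := by
  rw [LinearMap.trace_eq_sum_inner _ (EuclideanSpace.basisFun (Fin 3) ℝ),
    LinearMap.trace_eq_sum_inner _ (EuclideanSpace.basisFun (Fin 3) ℝ)]
  refine Finset.sum_congr rfl fun i _ => ?_
  rw [ContinuousLinearMap.coe_coe, ContinuousLinearMap.coe_coe, ContinuousLinearMap.adjoint_inner_right, real_inner_comm]

/-- ★ **The classification (trace-free).**  For every `A : ℝ³ →L[ℝ] ℝ³` with `tr A = 0` and every `v`: either the affine
discriminant of `v + A z` is non-zero somewhere, or there is `w ≠ 0` with `A ∘ [w]× = [w]× ∘ A` and `w × v = 0`. -/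
theorem affDisc_ne_zero_or_aligned (A : E3 →L[ℝ] E3) (v : E3) (htr : LinearMap.trace ℝ E3 (A : E3 →ₗ[ℝ] E3) = 0) :
    (∃ z₀ : E3, ⟪z₀, cross (v + (A + ContinuousLinearMap.adjoint A) z₀)
      ((ContinuousLinearMap.adjoint A) (v + (A + ContinuousLinearMap.adjoint A) z₀)
        + (A + ContinuousLinearMap.adjoint A) (v + A z₀))⟫ ≠ 0) ∨
    (∃ w : E3, w ≠ 0 ∧ (∀ z : E3, A (cross w z) = cross w (A z)) ∧ cross w v = 0) := by
  -- an orthonormal eigenframe of the symmetrised gradient, with trace-free rates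
  have hsym : ((A + ContinuousLinearMap.adjoint A : E3 →L[ℝ] E3) : E3 →ₗ[ℝ] E3).IsSymmetric :=
    (ContinuousLinearMap.isSelfAdjoint_iff_isSymmetric.mp (by
      rw [ContinuousLinearMap.isSelfAdjoint_iff']
      exact adjoint_symmPart A))
  have hn : Module.finrank ℝ E3 = 3 := by simp
  set b := hsym.eigenvectorBasis hn with hbdef
  set ev : Fin 3 → ℝ := hsym.eigenvalues hn with hevdef
  have hM : ∀ i, (A + ContinuousLinearMap.adjoint A) (b i) = ev i • b i := fun i => hsym.apply_eigenvectorBasis hn i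
  have hu : Orthonormal ℝ (⇑b) := b.orthonormal
  have hsum : ev 0 + ev 1 + ev 2 = 0 := by
    have h1 := hsym.trace_eq_sum_eigenvalues hn
    have h2 : LinearMap.trace ℝ E3 ((A + ContinuousLinearMap.adjoint A : E3 →L[ℝ] E3) : E3 →ₗ[ℝ] E3) = 0 := by
      rw [ContinuousLinearMap.toLinearMap_add, map_add, trace_adjoint, htr, add_zero]
    rw [h2] at h1
    have h3 : ∑ i, ev i = 0 := by
      have := h1.symm
      simpa only [hevdef, RCLike.ofReal_real_eq_id, id_eq] using this
    simpa [Fin.sum_univ_three] using h3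
  -- Case A: the LINEAR discriminant is non-zero somewhere (then so is the affine one, by density)
  have caseL : (∃ d : E3, ⟪d, cross ((A + ContinuousLinearMap.adjoint A) d)
      ((ContinuousLinearMap.adjoint A) ((A + ContinuousLinearMap.adjoint A) d)
        + (A + ContinuousLinearMap.adjoint A) (A d))⟫ ≠ 0) →
      (∃ z₀ : E3, ⟪z₀, cross (v + (A + ContinuousLinearMap.adjoint A) z₀)
        ((ContinuousLinearMap.adjoint A) (v + (A + ContinuousLinearMap.adjoint A) z₀)
          + (A + ContinuousLinearMap.adjoint A) (v + A z₀))⟫ ≠ 0) := by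
    rintro ⟨d, hd⟩
    set M : E3 →L[ℝ] E3 := A + ContinuousLinearMap.adjoint A with hMdef
    set Q : E3 →L[ℝ] E3 := (ContinuousLinearMap.adjoint A).comp M + M.comp A with hQ
    have hQapply : ∀ z, Q z = (ContinuousLinearMap.adjoint A) (M z) + M (A z) := fun z => rfl
    have hexp : ∀ z : E3, (ContinuousLinearMap.adjoint A) (v + M z) + M (v + A z)
        = ((ContinuousLinearMap.adjoint A) v + M v) + Q z := fun z => by
      rw [hQapply, map_add, map_add]; abel
    have hd' : ⟪d, cross (M d) (Q d)⟫ ≠ 0 := by rw [hQapply]; exact hd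
    obtain ⟨z₀, hz₀⟩ := (dense_affDisc_ne_zero v ((ContinuousLinearMap.adjoint A) v + M v) M Q hd').nonempty
    exact ⟨z₀, by rw [hexp]; exact hz₀⟩
  -- the two-rate alternative for any relabelled frame with the pattern `e₀ = e₁ ≠ e₂`
  have twoRate : ∀ (u : Fin 3 → E3) (e : Fin 3 → ℝ), Orthonormal ℝ u →
      (∀ i, (A + ContinuousLinearMap.adjoint A) (u i) = e i • u i) → e 0 = e 1 → e 1 ≠ e 2 → e 0 + e 1 + e 2 = 0 →
      (∃ z₀ : E3, ⟪z₀, cross (v + (A + ContinuousLinearMap.adjoint A) z₀)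
        ((ContinuousLinearMap.adjoint A) (v + (A + ContinuousLinearMap.adjoint A) z₀)
          + (A + ContinuousLinearMap.adjoint A) (v + A z₀))⟫ ≠ 0) ∨
      (∃ w : E3, w ≠ 0 ∧ (∀ z : E3, A (cross w z) = cross w (A z)) ∧ cross w v = 0) :=
    fun u e hu' hM' h01 h12 hs => affDisc_twoRate_cases hu' h01 h12 hs hM'
  by_cases h01 : ev 0 = ev 1
  · by_cases h12 : ev 1 = ev 2
    · -- isotropic: `A = (e/2)·id + [ω]×`
      obtain ⟨ω, hω⟩ := eq_smul_add_cross_of_isotropic hu h01 h12 hM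
      by_cases hω0 : ω = 0
      · right
        by_cases hv0 : v = 0
        · refine ⟨b 0, hu.ne_zero 0, fun z => ?_, by rw [hv0]; exact (crossCLM (b 0)).map_zero⟩
          rw [hω, hω z, hω0]
          simp only [← crossCLM_apply, map_zero, zero_apply, add_zero, map_smul]
        · refine ⟨v, hv0, fun z => ?_, KinematicShadow.PointSource.cross_self v⟩
          rw [hω, hω z, hω0]
          simp only [← crossCLM_apply, map_zero, zero_apply, add_zero, map_smul]
      · by_cases hωv : cross ω v = 0
        · exact Or.inr ⟨ω, hω0, commute_cross_of_eq_smul_add_cross hω, hωv⟩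
        · exact Or.inl (affDisc_isotropic_ne_zero hω hωv)
    · exact twoRate (⇑b) ev hu hM h01 h12 hsum
  · by_cases h12 : ev 1 = ev 2
    · obtain ⟨hu', hM'⟩ := frame_relabel ![1, 2, 0] (by decide) hu hM
      exact twoRate (⇑b ∘ ![1, 2, 0]) (ev ∘ ![1, 2, 0]) hu' hM' (by simpa using h12)
        (by simpa using fun h : ev 2 = ev 0 => h01 (h12.trans h).symm) (by simp; linarith)
    · by_cases h02 : ev 0 = ev 2
      · obtain ⟨hu', hM'⟩ := frame_relabel ![2, 0, 1] (by decide) hu hM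
        exact twoRate (⇑b ∘ ![2, 0, 1]) (ev ∘ ![2, 0, 1]) hu' hM' (by simpa using h02.symm) (by simpa using h01)
          (by simp; linarith)
      · exact Or.inl (caseL (linDisc_exists_ne_zero_of_triaxial A (⇑b) ev hu (injective_of_pairwise_ne h01 h12 h02) hM))

/-- ★★★ **THE INVISCID LINEARISED WALL ABOUT AN ARBITRARY POINT, DECIDED AT FIRST ORDER.**  Let `u = v + A(x − x₀)` be a
divergence-free affine drift (`tr A = 0`; the 1-jet of any smooth incompressible flow at `x₀`).  There is a smooth field `B`,
frozen into `u` (`∂ₜB + DB[u] − A B = 0`) and tangent to the spheres about `x₀` on some open `I × U`, NOT identically zero there,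
IF AND ONLY IF the jet is axisymmetric about an axis through `x₀`: `A` commutes with a rotation generator `z ↦ w × z` (`w ≠ 0`)
and the centre value lies on the axis (`w × v = 0`).  (⇒: `affDisc_ne_zero_or_aligned` + `affineFlowRigidity_of_exists_ne_zero`;
⇐: the steady witness `w × (x − x₀)` of `affineFlow_frozen_witness`.) -/
theorem inviscidAffineFlow_dichotomy (A : E3 →L[ℝ] E3) (v x₀ : E3) (htr : LinearMap.trace ℝ E3 (A : E3 →ₗ[ℝ] E3) = 0) :
    (∃ (B : ℝ → E3 → E3) (I : Set ℝ) (U : Set E3), IsOpen I ∧ IsOpen U ∧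
        ContDiffOn ℝ (⊤ : ℕ∞) (uncurry B) (I ×ˢ U) ∧
        (∀ t ∈ I, ∀ x ∈ U, deriv (fun s => B s x) t + fderiv ℝ (B t) x (v + A (x - x₀)) - A (B t x) = 0) ∧
        (∀ t ∈ I, ∀ x ∈ U, ⟪B t x, x - x₀⟫ = 0) ∧ ∃ t ∈ I, ∃ x ∈ U, B t x ≠ 0) ↔
    ∃ w : E3, w ≠ 0 ∧ (∀ z : E3, A (cross w z) = cross w (A z)) ∧ cross w v = 0 := by
  constructor
  · rintro ⟨B, I, U, hI, hU, hB, hfrozen, htan, t, ht, x, hx, hne⟩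
    rcases affDisc_ne_zero_or_aligned A v htr with ⟨z₀, hz₀⟩ | hax
    · exact absurd (affineFlowRigidity_of_exists_ne_zero v A x₀ B I U hI hU hB hfrozen htan hz₀ t ht x hx) hne
    · exact hax
  · rintro ⟨w, hw, hcomm, hwv⟩
    obtain ⟨hfro, htan⟩ := affineFlow_frozen_witness v A x₀ w hcomm hwv
    obtain ⟨y, hy⟩ := exists_cross_ne_zero hw
    refine ⟨fun _ x => cross w (x - x₀), univ, univ, isOpen_univ, isOpen_univ, ?_, fun t _ x _ => hfro t x,
      fun t _ x _ => htan x, 0, mem_univ _, x₀ + y, mem_univ _, by simpa using hy⟩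
    exact ((crossCLM w).contDiff.comp (contDiff_snd.sub contDiff_const)).contDiffOn

end Dichotomy

end Summit.NavierStokesRegularity.NavierStokesRegularity.Theorems.PoloidalLiouville.ErtelTower

end
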